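import Summits.CriticalPhenomena.CardyFormulaZ2.Theorems.CardyBoundaryCoulombGasAssembly
import Summits.CriticalPhenomena.CardyFormulaZ2.Theorems.RectilinearCardy.Negative.RectilinearCardyShells
import Summits.CriticalPhenomena.CardyFormulaZ2.Theorems.RectilinearCardy.Negative.RectilinearCardyLShape
import Summits.CriticalPhenomena.CardyFormulaZ2.Theorems.CardyBoundaryCoulombGasRectilinearCardyOfEngineMember
import Summits.CriticalPhenomena.CardyFormulaZ2.Theorems.CardySelfRefinementInterfaceToCardy
import Summits.CriticalPhenomena.CardyFormulaZ2.Theses.CardyMonotoneApproach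
import Summits.CriticalPhenomena.CardyFormulaZ2.Theses.CardyHausdorffMoment
import Summits.CriticalPhenomena.CardyFormulaZ2.Theses.CardyPolygonWords
import Literature.Barriers.CriticalPhenomena.SmirnovTriangularOnly
import Literature.Barriers.CriticalPhenomena.FKParafermionicHalfCauchyRiemann
import HarnessLib

/-!
# Strategy census for the crux `RectilinearCardy` (stmt-CriticalPhenomena-5660) — Lean record

Crux-strategist seat `cstrat-stmt-CriticalPhenomena-5660-s1` (2026-08-17), route
`CardyBoundaryCoulombGas` of `CriticalPhenomena/CardyFormulaZ2`. Companion of `STRATEGY-CENSUS.md`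
(same crux directory): every typed claim of the census is checked here, sorry-free, over landed
declarations only. Nothing in this file is a new item, a stub or a line; it records WHY the four
language switches (transfer / strengthen / decomposition / negation) give no leverage short of the
summit conjunct.

* §0 `crux_iff_conjunct` — the crux is LITERALLY EQUIVALENT to the sub-problem statement
  `CardyFormulaZ2` (→ is the landed support `RectilinearSuffices_proof`, ← is restriction), so every
  strategy for the crux is a route for the conjunct.
* §1 Decomposition (D1): `RectilinearTransport` (formula-free conformal-invariance transport among
  rectilinear quads of equal modulus) and `crux_iff_split :
  RectilinearCardy ↔ RectCardy ∧ RectilinearTransport` — a genuine typed two-piece split with both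
  directions proved; `transport_of_confInvTransport` shows the transport piece is a restriction of the
  sibling crux `ConfInvTransport` (stmt-0794, wanted by CardyMonotoneApproach / CardyHausdorffMoment /
  CardyUniqueLimit / CardyHarmonicInvariants) and the other piece is the sibling target `RectCardy`
  (stmt-5843): the split is the spine of `CardyMonotoneApproach.closes`, already in the ledger.
  (D2) `cardyLatticePolygon_of_crux'` — the crux gives the sibling target `CardyLatticePolygon`
  (stmt-4781; the converse is the landed sandwich technology of `RectilinearSuffices_proof`).
* §2 Strengthen: (S1) `crux_of_sle6Thesis` — SLE₆ convergence of the bond-ℤ² interface (the target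
  `CardyRotToConfThesis` of route CardyRotToConf) implies the crux through the LANDED
  `cardyRotToConfSLE6ToCardy_proof`; (S2) `RectilinearCardyRate`, `crux_of_rate` — Cardy with a
  power-law rate; (S3) the `(4;(1,3,1,1);1)` engine member, `rectilinearCardy_of_engineMember1311`
  (landed by the lead, line excursion-kernel-covariance).
* §3 Negation: the landed Negative lemmas that bound what a counterexample can be (`law_eqOn`,
  `not_rectilinear_law_of_exists_not_mem`, `tendsto_half_unitSquareQuad_of_rectilinearCardy`, `tendsto_half_lShapeQuad_of_rectilinearCardy`).
* §4 Transfer: the two catalogued barrier facts the transfers from site-𝕋 (Smirnov) and from FK-Ising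
  (`q = 2`) run into, by name.
-/

noncomputable section

namespace Summit.CriticalPhenomena.CardyFormulaZ2.Cruxes.RectilinearCardy.StrategyCensus

open Set Filter Topology
open Literature.Probability.RandomPlanarGeometry
open Literature.Probability.Percolation (bondDomainCrossingProb)
open Summit.CriticalPhenomena.CardyFormulaZ2.Theses.CardyBoundaryCoulombGas (RectilinearCardy
  RectilinearSuffices BoundaryDefectGaussianR)
open Summit.CriticalPhenomena.CardyFormulaZ2.Theorems.RectilinearCardy.Negative

/-! ## §0 The crux is the conjunct -/

/-- **`RectilinearCardy ↔ CardyFormulaZ2`.** Forward: the landed support `RectilinearSuffices_proof`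
(Bollobás–Riordan sandwich, route item stmt-5663); backward: restriction to rectilinear quads.
Consequently "short of the summit" is empty for this crux in the logical sense: any proof of the crux
is a proof of the conjunct. [folklore] -/
theorem crux_iff_conjunct : RectilinearCardy ↔ _root_.CardyFormulaZ2 :=
  ⟨fun h => Theorems.RectilinearSuffices_proof h, fun h R _ => h R⟩

/-! ## §1 Decomposition -/

/-- (D1, transport piece) **Formula-free conformal-invariance transport among rectilinear quads**:
two rectilinear conformal rectangles with the same modulus have the same limiting bond-ℤ² crossing
probability whenever one of them has a limit. Strictly weaker in form than the sibling crux
`ConfInvTransport` (all conformal rectangles). [folklore] -/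
def RectilinearTransport : Prop :=
  ∀ R R' : ConformalRectangle, IsRectilinear R → IsRectilinear R' → modulus R = modulus R' →
    ∀ L : ℝ, Tendsto (bondDomainCrossingProb R) (𝓝[>] 0) (𝓝 L) →
      Tendsto (bondDomainCrossingProb R') (𝓝[>] 0) (𝓝 L)

/-- The crux gives the sibling target `RectCardy` (stmt-5843; routes CardyMonotoneApproach,
CardyHausdorffMoment): axis-parallel rectangles are rectilinear. [folklore] -/
theorem rectCardy_of_crux (h : RectilinearCardy) : Theses.CardyMonotoneApproach.RectCardy :=
  fun R _ _ hw hh hcar _ => h R (isRectilinear_of_carrier_eq hw hh hcar)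

/-- The crux gives the transport piece (uniqueness of limits along the non-trivial filter `𝓝[>] 0`).
[folklore] -/
theorem transport_of_crux (h : RectilinearCardy) : RectilinearTransport := by
  intro R R' hR hR' hmod L hL
  have h1 := (rectilinearCardy_iff_modulus.1 h) R hR
  have h2 := (rectilinearCardy_iff_modulus.1 h) R' hR'
  have hLeq : L = cardyFunction (modulus R) := tendsto_nhds_unique hL h1
  rw [hLeq, hmod]
  exact h2

/-- (D1, glue) **`RectCardy → RectilinearTransport → RectilinearCardy`**: realise the modulus of a
rectilinear quad by a Bollobás–Riordan rectangle (`rectangle_crossRatio_eq_of_aspectRatio_holds`,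
`brRect`), apply `RectCardy` there and transport. This is the best typed split of the crux into two
genuine pieces; it is the spine of `CardyMonotoneApproach.closes` restricted to rectilinear targets.
[folklore] -/
theorem crux_of_split (hRect : Theses.CardyMonotoneApproach.RectCardy) (hT : RectilinearTransport) :
    RectilinearCardy := by
  rw [rectilinearCardy_iff_modulus]
  intro R' hR'
  obtain ⟨g, -, himg, hall⟩ := rectangle_crossRatio_eq_of_aspectRatio_holds
  have hη : modulus R' ∈ g '' Ioi 0 := himg ▸ modulus_mem_Ioo R'
  obtain ⟨r, hr, hgr⟩ := hη
  have hRrect : IsRectilinear (brRect r 1 hr one_pos) := isRectilinear_brRect r 1 hr one_pos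
  have hRC := hRect (brRect r 1 hr one_pos) r 1 hr one_pos (brRect_carrier r 1 hr one_pos)
    (brRect_pt r 1 hr one_pos)
  have hlimR : Tendsto (bondDomainCrossingProb (brRect r 1 hr one_pos)) (𝓝[>] 0)
      (𝓝 (cardyFunction (modulus (brRect r 1 hr one_pos)))) :=
    hasCrossingLimit_iff_modulus.1 hRC
  have hmodR : modulus (brRect r 1 hr one_pos) = modulus R' := by
    have := hall (brRect r 1 hr one_pos) r 1 hr one_pos (brRect_carrier r 1 hr one_pos)
      (by simpa using brRect_pt r 1 hr one_pos) _ _ (isUniformizing_modulusDatum _)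
    rw [div_one] at this
    exact ((crossRatio_eq_modulus (isUniformizing_modulusDatum _)).symm.trans this).trans hgr
  have := hT _ R' hRrect hR' hmodR _ hlimR
  rwa [hmodR] at this

/-- **The split is an equivalence**: `RectilinearCardy ↔ RectCardy ∧ RectilinearTransport`. Both pieces
are open, both are existing sibling items up to restriction (next theorem), and the transport piece
carries conformal invariance proper — see `STRATEGY-CENSUS.md §Decomposition` for why neither piece is
smaller than the crux in difficulty. [folklore] -/
theorem crux_iff_split :
    RectilinearCardy ↔ (Theses.CardyMonotoneApproach.RectCardy ∧ RectilinearTransport) :=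
  ⟨fun h => ⟨rectCardy_of_crux h, transport_of_crux h⟩, fun h => crux_of_split h.1 h.2⟩

/-- The transport piece is a restriction of the sibling crux `ConfInvTransport` (stmt-0794). [folklore] -/
theorem transport_of_confInvTransport (h : Theses.CardyMonotoneApproach.ConfInvTransport) :
    RectilinearTransport := by
  intro R R' _ _ hmod L hL
  have hx : crossRatio (Classical.choose (Classical.choose_spec
        (MarkedDomain.exists_isUniformizing_holds R))) =
      crossRatio (Classical.choose (Classical.choose_spec
        (MarkedDomain.exists_isUniformizing_holds R'))) := by
    rw [crossRatio_eq_modulus (isUniformizing_modulusDatum R),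
      crossRatio_eq_modulus (isUniformizing_modulusDatum R'), hmod]
  exact h R R' _ _ _ _ (isUniformizing_modulusDatum R) (isUniformizing_modulusDatum R') hx L hL

/-- The two copies of `RectCardy` (CardyMonotoneApproach / CardyHausdorffMoment, item stmt-5843) agree.
[folklore] -/
theorem rectCardy_iff : Theses.CardyHausdorffMoment.RectCardy ↔ Theses.CardyMonotoneApproach.RectCardy := Iff.rfl

/-- (D2) The crux gives the sibling target `CardyLatticePolygon` (stmt-4781, routes CardyPolygonWords
and CardyGluingRDE): lattice polygons of any mesh are rectilinear (`isRectilinear_of_carrier_eq_interior`,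
landed). The converse needs only the inner/outer sandwich of `RectilinearSuffices_proof`, so 4781 is a
third equivalent form of the crux, not a piece of it. [folklore] -/
theorem cardyLatticePolygon_of_crux' (h : RectilinearCardy) : Theses.CardyPolygonWords.CardyLatticePolygon :=
  fun R ⟨_, hδ₀, ⟨_, hcar⟩, _⟩ ↦ h R (isRectilinear_of_carrier_eq_interior hδ₀ hcar)

/-! ## §2 Strengthen -/

/-- (S1) **SLE₆ convergence ⇒ crux**: the target `CardyRotToConfThesis` of route CardyRotToConf
(convergence in law of the bond-ℤ² exploration interface to chordal SLE₆ in every Dobrushin domain,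
every admissible discretisation family) implies `CardyFormulaZ2` by the LANDED
`cardyRotToConfSLE6ToCardy_proof` (stmt-10278), hence the crux. The strengthening is typed and its
glue is a theorem; it buys nothing for THIS step because every known proof of S1 passes through Cardy
in all domains first (Smirnov 2001 + Camia–Newman 2007), and the symmetry-upgrade shortcut was
refuted as typed (`Theorems.not_SymmetryUpgrade`, stmt-0698) with its repair stmt-17237 open.
[folklore] -/
theorem crux_of_sle6Thesis (h : Theses.CardyRotToConf.CardyRotToConfThesis) : RectilinearCardy :=
  crux_iff_conjunct.2 (Theorems.cardyRotToConfSLE6ToCardy_proof h)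

/-- (S2) **Cardy with a power-law rate** on rectilinear quads. [folklore] -/
def RectilinearCardyRate : Prop :=
  ∃ ε : ℝ, 0 < ε ∧ ∀ R : ConformalRectangle, IsRectilinear R → ∃ C δ₀ : ℝ, 0 < δ₀ ∧
    ∀ δ : ℝ, 0 < δ → δ < δ₀ → |bondDomainCrossingProb R δ - cardyFunction (modulus R)| ≤ C * δ ^ ε

/-- (S2, glue) a rate implies the crux (squeeze). The added rigidity admits no induction in `δ`:
crossing probabilities at mesh `δ` do not determine those at mesh `δ/2` (no closed recursion), and
the printed rate theorems (Mendelson–Nachmias–Watson 2014; Binder–Chayes–Lei) post-process Smirnov's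
observable. [folklore] -/
theorem crux_of_rate (h : RectilinearCardyRate) : RectilinearCardy := by
  rw [rectilinearCardy_iff_modulus]
  intro R hR
  obtain ⟨ε, hε, hall⟩ := h
  obtain ⟨C, δ₀, hδ₀, hb⟩ := hall R hR
  have hpow : Tendsto (fun δ : ℝ => C * δ ^ ε) (𝓝[>] 0) (𝓝 0) := by
    have h1 : Tendsto (fun δ : ℝ => δ ^ ε) (𝓝 (0:ℝ)) (𝓝 ((0:ℝ) ^ ε)) :=
      (Real.continuousAt_rpow_const 0 ε (Or.inr hε.le)).tendsto
    rw [Real.zero_rpow hε.ne'] at h1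
    simpa using (h1.mono_left nhdsWithin_le_nhds).const_mul C
  have hev : ∀ᶠ δ in 𝓝[>] (0:ℝ),
      ‖bondDomainCrossingProb R δ - cardyFunction (modulus R)‖ ≤ C * δ ^ ε := by
    filter_upwards [Ioo_mem_nhdsGT hδ₀] with δ hδ
    simpa only [Real.norm_eq_abs] using hb δ hδ.1 hδ.2
  exact tendsto_sub_nhds_zero_iff.1 (squeeze_zero_norm' hev hpow)

/-- (S3) **The engine member ⇒ crux** is the lead's landed composition
`ExcursionKernelCovariance.rectilinearCardy_of_engineMember1311` (p136585): the smallest six-vertex-side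
statement known to serve the crux; it is the `(k=4; L=(1,3,1,1); j=1)` instance of the engine crux
`BoundaryDefectGaussianR` (stmt-14132, open), `engineMember1311_of_engine`. [folklore] -/
example := @ExcursionKernelCovariance.rectilinearCardy_of_engineMember1311

/-- (S3') and the member is the engine specialised. [folklore] -/
example := @ExcursionKernelCovariance.engineMember1311_of_engine

/-! ## §3 Negation — what a counterexample must be (landed Negative lemmas) -/

/-- Any two scaling laws for which the crux holds agree on `(0,1)`: a counterexample is a rectilinear
quad whose crossing probabilities converge to something other than `F(modulus)`, i.e. `¬CardyFormulaZ2`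
(Schramm's Problem 2.11 answered in the negative). [folklore] -/
example := @law_eqOn

/-- Only laws leaving `(0,1)` are refutable unconditionally (RSW). [folklore] -/
example := @not_rectilinear_law_of_exists_not_mem

/-- The cheapest instance: crux ⇒ `P[square crossing] → 1/2` (true numerically, `0.512 → 1/2` at
`δ = 2/64`, NUMERICS-local.md; near-miss `SquareCrossingHalf` in `Disproof.lean` §4). [folklore] -/
example := @tendsto_half_unitSquareQuad_of_rectilinearCardy

/-- The route's own fear, reflex corners: crux ⇒ `P → 1/2` on the L-shape `(0,2)² ∖ [1,2]²` with a mark AT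
the reflex corner (modulus `1/2` by the diagonal anti-conformal symmetry); true numerically to `0.3 %` up to
`N = 513` (NUMERICS-Lshape2.md). [folklore] -/
example := @tendsto_half_lShapeQuad_of_rectilinearCardy

/-! ## §4 Transfer — the catalogued barrier facts the two classical transfers meet -/

/-- Site-𝕋 → bond-ℤ² (Smirnov 2001 via the harmonic-conjugate triple): Beffara's `ψ`-criterion —
the discrete contour defect vanishes identically iff the dual faces are equilateral triangles.
[cite: Beffara2008Universal, §3–§4.1 (arXiv pp. 11–13)] -/
example := @Literature.Barriers.CriticalPhenomena.SmirnovTriangularOnly_holds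

/-- FK-Ising (`q = 2`, Chelkak–Duminil-Copin–Hongler 2016 crossing probabilities) → `q = 1`: the FK
parafermionic vertex relations at `σ = 1/3` are half of the discrete Cauchy–Riemann equations and do
not determine the observable. [cite: DuminilCopinSmirnov2012Lattice, §8.3.1 Proposition 8.6] -/
example := @Literature.Barriers.CriticalPhenomena.FKParafermionicHalfCauchyRiemann_holds

end Summit.CriticalPhenomena.CardyFormulaZ2.Cruxes.RectilinearCardy.StrategyCensus

end
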